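import Summits.QuantumFields.YangMills.Theorems.BalabanUVNodesN15KingModelPotentialDressedDeriv
import Summits.QuantumFields.YangMills.Theorems.BalabanUVNodesN15KingModelPotentialDressedTower
import Literature.Analysis.Matrix.LogDetDerivative

/-!
# Route «BalabanUVNodes» (K4 «SpineRates»), node N15 = NE2 — THE KING-MODEL RUNG, part 9f: THE FULLY DRESSED COVARIANCE IS `C¹` IN THE COUPLING AT EVERY
# POINT OF THE WINDOW, WITH A LOCAL DERIVATIVE — `∂_t (Δ^{(k)}_{tv} + aL⁻²Q*Q)⁻¹ = −C_{tv}·(∂_tΔ^{(k)}_{tv})·C_{tv}`, `|∂_t C_{tv}^{(k)}(x,y)| ≤ c·sup|v|·e^{−δ₄₅|x−y|}`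

Cell `pub-ymgap`, Track A (D-0062), seat `pub-ymgap-dag-n15-d` (R134 seat, strategy s3, gen 7).  `bears_on: R4∕N15`; `--supports` the K3‴ item
`SpineGivenEndpointR13` (stmt-QuantumFields-19912).  COUNT-NEUTRAL; 0 `def`.  Imports parts 9e (Hellmann–Feynman at every coupling), 9c (the fully dressed
tower by name) and the tree's `Literature/Analysis/Matrix/LogDetDerivative` (`hasDerivAt_inv_apply`: `d∕ds ℳ(s)⁻¹ = −ℳ⁻¹ℳ′ℳ⁻¹` entrywise at an
invertible point, for ANY entrywise-differentiable matrix path — the nonlinear counterpart of part 7c's affine `hasDerivAt_inv_affine_apply`).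

WHAT THIS FILE PROVES (kernel).  Part 7c differentiated the covariances of towers dressed AFFINELY in the coupling (`Δ + u·P`); the FULL dressing
`u ↦ Δ_eff(u·w)` is nonlinear (a resolvent), and part 9e supplied its derivative.  Here:
* §1 (generic, any torus ∕ fine count, any block term `B`): ★ **`hasDerivAt_covPot_smul`** — if `Δ_eff(t·w) + B` is invertible, then for all sites
  `HasDerivAt (u ↦ (Δ_eff(u·w) + B)⁻¹ x y) (−((Δ_eff(tw)+B)⁻¹·D_t·(Δ_eff(tw)+B)⁻¹) x y) t` with `D_t = a²N^d·Q(A₀+tw)⁻¹diag(w)(A₀+tw)⁻¹Qᵀ` the dressed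
  sandwich (9e); `triple_entry_decay` — a local kernel sandwiched between two decaying kernels decays (7a's `mul_entry_decay_right` twice).
* §2 (King by name, along the run): ★★ **`hasDerivAt_kingCovPot_smul`** — for a potential tower `v` with `sup|v| ≤ w₁` and couplings `|t| < T` with
  `T·w₁` inside the window (`≤ w̄` and `c_E(T·w₁) ≤ c̄`), at every level `j` and all sites,
  `HasDerivAt (u ↦ C^{(j)}_{u·v}(x,y)) (−(C^{(j)}_{tv}·D^{(j)}_t·C^{(j)}_{tv})(x,y)) t` (`C^{(j)}_{v} = (Δ^{(max j 1)}_v + aL⁻²Q*Q)⁻¹ = kingCovE (fullPert v) j`);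
  ★★ **`deriv_kingCovPot_smul_le`** — `|∂_t C^{(j)}_{tv}(x,y)| ≤ (4∕γ₀)²·V·(a²ctCK²K_W·w₁)·V·e^{−δ₄₅|x−y|_T}` uniformly in `j`, `t`, the volume and `m²`:
  THE FULLY DRESSED COVARIANCE IS CONTINUOUSLY DIFFERENTIABLE IN THE COUPLING THROUGHOUT THE WINDOW WITH AN EXPONENTIALLY LOCAL DERIVATIVE — the
  position-space, nonperturbative form of the Spine's «NE2-LIP ⇒ differentiability in the background coupling» station for King's model (real
  couplings; 7c's affine case recovered to first order).

HONEST FRAMING ∕ LIMITS.  King's `A = 0` SCALAR block-spin tower; a potential is NOT a gauge field; real couplings only (no holomorphic extension);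
nothing is Bałaban's `Δ^{(k)}(U) − Δ^{(k)}(1)` ∕ `C^{(k)}(Λ;U)` (η-differences NOT PRINTED); the (H3) letter of the full dressing remains READ (9d); NOT a node
discharge; typed 28∕28, discharged count untouched; one finite torus at fixed ε — NOT ℝ⁴ ∕ OS ∕ mass gap ∕ Clay.  Locators: [King1986] CMP **102** (1986):
(4.32)–(4.34) p. 674, (4.39) p. 674, (4.40)–(4.41) p. 675; [AlbergoEtAl2021Fermions] App. C (C2) (the matrix-inverse derivative, tree lemma).
-/

noncomputable section

open scoped BigOperators Matrix
open Finset

namespace Summit.QuantumFields.YangMills.BalabanUVNodes.N15.KingModel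

open Literature.MathematicalPhysics.QuantumFieldTheory.Balaban1983to89 hiding blockOf
open Literature.MathematicalPhysics.QuantumFieldTheory.Balaban1983to89.QGQInverse (Coercive isUnit_of_coercive)
open Literature.MathematicalPhysics.QuantumFieldTheory.Balaban1983to89.B4Sect5Proof (latticeConst latticeConst_nonneg)
open Literature.MathematicalPhysics.QuantumFieldTheory.Balaban1983to89.B5Prop11Plancherel (Tor fine)
open Literature.MathematicalPhysics.QuantumFieldTheory.King1986 (aK aK_pos exp_decay_mono)
open Literature.MathematicalPhysics.QuantumFieldTheory.King1986.Torus
open Summit.QuantumFields.BalabanUV.T4Continuum.NE2KingTransplant (IsPseudoMetric UniformCoercive UniformCTBound UniformKernelDecay VolumeSum)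
open Literature.Analysis.Matrix.LogDetDerivative (hasDerivAt_inv_apply)

variable {d : ℕ}

/-! ## §1 Generic: the derivative of `(Δ_eff(u·w) + B)⁻¹` and the locality of a sandwiched local kernel -/

section Generic

variable {N : ℕ} [NeZero N] {U : Fin (d + 1) → ℕ} [∀ μ, NeZero (U μ)] {a m2 : ℝ}

/-- **THE DERIVATIVE OF THE DRESSED COVARIANCE IN THE COUPLING (generic block term).**  For `a, m² ≥ 0`, a direction `w` with `sup|w| ≤ w₁`, a coupling
`t` with `|t|·w₁ < w₀ < γ_A`, and any matrix `B` with `Δ_eff(t·w) + B` invertible: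
`HasDerivAt (u ↦ (Δ_eff(u·w) + B)⁻¹ x y) (−((Δ_eff(tw) + B)⁻¹·D_t·(Δ_eff(tw) + B)⁻¹) x y) t`, `D_t = a²N^{d+1}·Q(A₀+tw)⁻¹diag(w)(A₀+tw)⁻¹Qᵀ` (part 9e's
dressed sandwich) — the tree's entrywise matrix-inverse derivative on 9e's `hasDerivAt_effLaplacianPot_smul`. [cite: King1986, (4.39)–(4.40) pp.674–675; AlbergoEtAl2021Fermions, App. C (C2)] -/
theorem hasDerivAt_covPot_smul (ha : 0 ≤ a) (hm : 0 ≤ m2) {w : Tor (fine N U) → ℝ} {w₀ w₁ t : ℝ} (hw : ∀ x, |w x| ≤ w₁)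
    (ht : |t| * w₁ < w₀) (hw₀ : w₀ < gamA a (d + 1)) (B : Matrix (Tor U) (Tor U) ℝ)
    (hB : IsUnit (effLaplacianPot N U a ((N : ℝ) ^ 2) m2 (t • w) + B).det) (x y : Tor U) :
    HasDerivAt (fun u : ℝ => (effLaplacianPot N U a ((N : ℝ) ^ 2) m2 (u • w) + B)⁻¹ x y)
      (-(((effLaplacianPot N U a ((N : ℝ) ^ 2) m2 (t • w) + B)⁻¹
        * ((a ^ 2 * (N : ℝ) ^ (d + 1)) • (Qmat N U * ((fineOpPot N U a ((N : ℝ) ^ 2) m2 (t • w))⁻¹ * Matrix.diagonal w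
            * (fineOpPot N U a ((N : ℝ) ^ 2) m2 (t • w))⁻¹) * (Qmat N U)ᵀ))
        * (effLaplacianPot N U a ((N : ℝ) ^ 2) m2 (t • w) + B)⁻¹) x y)) t := by
  refine hasDerivAt_inv_apply (𝕜 := ℝ) (M := fun u : ℝ => effLaplacianPot N U a ((N : ℝ) ^ 2) m2 (u • w) + B) (fun p q => ?_) hB x y
  have h := (hasDerivAt_effLaplacianPot_smul (N := N) (U := U) (m2 := m2) ha hm hw ht hw₀ p q).add_const (B p q)
  exact h.congr_deriv (by rw [Matrix.smul_apply, smul_eq_mul])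

/-- **A LOCAL KERNEL SANDWICHED BETWEEN TWO DECAYING KERNELS DECAYS** (part 7a's two-kernel composition twice, with the Combes–Thomas surplus): if
`|P| ≤ p·e^{−κd}`, `|R| ≤ p·e^{−κd}` and `|D| ≤ q·e^{−2κd}` with the volume sum `Σ_z e^{−(κ∕2)d(x,z)} ≤ V`, then `|(P·D·R)(x,y)| ≤ p²qV²·e^{−(κ∕2)d(x,y)}`. [folklore] -/
theorem triple_entry_decay {n : Type} [Fintype n] [DecidableEq n] {dm : n → n → ℝ} (hd : IsPseudoMetric dm) {κ V p q : ℝ} (hκ : 0 ≤ κ) (hp : 0 ≤ p)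
    {P D R : Matrix n n ℝ} (hP : ∀ x z, |P x z| ≤ p * Real.exp (-(κ * dm x z))) (hD : ∀ z u, |D z u| ≤ q * Real.exp (-(2 * κ * dm z u)))
    (hR : ∀ u y, |R u y| ≤ p * Real.exp (-(κ * dm u y))) (h4 : VolumeSum dm κ V) (x y : n) :
    |(P * D * R) x y| ≤ p ^ 2 * q * V ^ 2 * Real.exp (-(κ / 2 * dm x y)) := by
  have h1 : ∀ x u, |(P * D) x u| ≤ p * q * V * Real.exp (-(κ * dm x u)) :=
    mul_entry_decay_right hd hκ hp le_rfl (by linarith) hP hD h4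
  have h2 := mul_entry_decay_left (P := P * D) (Q := R) hd (δ := κ / 2) (by positivity) (by linarith) (by linarith) h1 hR h4 x y
  refine h2.trans (le_of_eq ?_)
  ring

end Generic

/-! ## §2 King by name: `∂_t C^{(j)}_{tv} = −C^{(j)}_{tv}·D^{(j)}_t·C^{(j)}_{tv}`, local uniformly in the level and the coupling -/

section King

variable {a m2 : ℝ} {L : ℕ} [NeZero L] {M : Fin (d + 1) → ℕ} [∀ μ, NeZero (M μ)]

omit [NeZero L] [∀ μ, NeZero (M μ)] in
/-- Scaling a potential tower: `(t • v) N = t • v N`. [folklore] -/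
theorem smul_tower_apply (t : ℝ) (v : ∀ N : ℕ, Tor (fine N (fine L M)) → ℝ) (N : ℕ) : (t • v) N = t • v N := rfl

omit [NeZero L] [∀ μ, NeZero (M μ)] in
/-- A scaled tower stays in the size window: `sup|t·v| ≤ |t|·w₁`. [folklore] -/
theorem abs_smul_tower_le {v : ∀ N : ℕ, Tor (fine N (fine L M)) → ℝ} {w₁ : ℝ} (hv : ∀ N x, |v N x| ≤ w₁) (t : ℝ) (N : ℕ)
    (x : Tor (fine N (fine L M))) : |(t • v) N x| ≤ |t| * w₁ := by
  show |t * v N x| ≤ |t| * w₁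
  rw [abs_mul]; exact mul_le_mul_of_nonneg_left (hv N x) (abs_nonneg t)

/-- **THE FULLY DRESSED COVARIANCE IS DIFFERENTIABLE IN THE COUPLING AT EVERY POINT OF THE WINDOW** (torus dimension `d + 1`, `L ≥ 2`, `a, m² > 0`):
for a potential tower `v` with `sup|v| ≤ w₁` and couplings `|t| < T` with `T·w₁ ≤ w̄` and `c_E := a²·ctCK²·K_W·(T·w₁) ≤ c̄`, at every level `j` and all sites
`HasDerivAt (u ↦ C^{(j)}_{u·v}(x,y)) (−(C^{(j)}_{tv}·D^{(j)}_t·C^{(j)}_{tv})(x,y)) t`, where `C^{(j)}_{v} = (Δ^{(max j 1)}_v + aL⁻²Q*Q)⁻¹` and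
`D^{(j)}_t = a_k²N^{d+1}·Q(A₀+tv_N)⁻¹diag(v_N)(A₀+tv_N)⁻¹Qᵀ` (`N = L^{max j 1}`, `a_k = aK a L (max j 1)`) — part 7c's `hasDerivAt_kingCovE_smul` for the
NONLINEAR (full) dressing. [cite: King1986, (4.32) p.674, (4.39)–(4.40) pp.674–675] -/
theorem hasDerivAt_kingCovPot_smul (ha : 0 < a) (hm : 0 < m2) (hL : 2 ≤ L) {v : ∀ N : ℕ, Tor (fine N (fine L M)) → ℝ} {w₁ T t : ℝ}
    (hv : ∀ N x, |v N x| ≤ w₁) (ht : |t| < T) (hT0 : 0 ≤ T) (hTw : T * w₁ ≤ wbarK (d + 1) a L)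
    (hsmall : a ^ 2 * ctCK (d + 1) a L ^ 2 * kwSum (d + 1) a L * (T * w₁) ≤ kingCbar (d + 1) a L) (j : ℕ) (x y : Tor (fine L M)) :
    HasDerivAt (fun u : ℝ => (kingTowerPot a m2 L M (u • v) j + kingBlock a L M)⁻¹ x y)
      (-(((kingTowerPot a m2 L M (t • v) j + kingBlock a L M)⁻¹
        * ((aK a L (max j 1) ^ 2 * ((L ^ max j 1 : ℕ) : ℝ) ^ (d + 1)) • (Qmat (L ^ max j 1) (fine L M)
            * ((fineOpPot (L ^ max j 1) (fine L M) (aK a L (max j 1)) (((L ^ max j 1 : ℕ) : ℝ) ^ 2) m2 (t • v (L ^ max j 1)))⁻¹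
              * Matrix.diagonal (v (L ^ max j 1))
              * (fineOpPot (L ^ max j 1) (fine L M) (aK a L (max j 1)) (((L ^ max j 1 : ℕ) : ℝ) ^ 2) m2 (t • v (L ^ max j 1)))⁻¹)
            * (Qmat (L ^ max j 1) (fine L M))ᵀ))
        * (kingTowerPot a m2 L M (t • v) j + kingBlock a L M)⁻¹) x y)) t := by
  have hj : 1 ≤ max j 1 := le_max_right j 1
  set N := L ^ max j 1 with hN
  have hw₁0 : 0 ≤ w₁ := (abs_nonneg _).trans (hv N (site N (fine L M) x (j0 N)))
  have hak : 0 < aK a L (max j 1) := aK_pos ha (one_lt_cast_of_two_le hL) hj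
  -- the coupling window at this level: `|t|·w₁ < T·w₁ ≤ w̄ < γ_A(a_k)`
  have hamin := aminL_pos ha hL
  obtain ⟨hk1, -⟩ := aminL_le_aK ha hL hj
  have hγ : wbarK (d + 1) a L < gamA (aK a L (max j 1)) (d + 1) := by
    have h1 : gamA (aminL a L) (d + 1) ≤ gamA (aK a L (max j 1)) (d + 1) := gamA_mono hk1 (d + 1)
    have h2 := gamA_pos hamin (d + 1)
    unfold wbarK; linarith
  have htw : |t| * w₁ < T * w₁ ∨ w₁ = 0 := by
    rcases hw₁0.eq_or_lt with h | h
    · exact Or.inr h.symm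
    · exact Or.inl (mul_lt_mul_of_pos_right ht h)
  -- invertibility of the dressed covariance at `t` (coercivity from 9c's leaves at the scaled tower)
  have hvt : ∀ N' x', |(t • v) N' x'| ≤ T * w₁ := fun N' x' =>
    (abs_smul_tower_le hv t N' x').trans (mul_le_mul_of_nonneg_right ht.le hw₁0)
  have hTw0 : 0 ≤ T * w₁ := mul_nonneg hT0 hw₁0
  have hco := uniformCoercive_kingTowerPot (M := M) ha hm hL hTw0 hTw hvt j
  have hγ0 := gam0L_pos (d := d + 1) ha hL
  have hpos : 0 < gam0L (d + 1) a L - a ^ 2 * ctCK (d + 1) a L ^ 2 * kwSum (d + 1) a L * (T * w₁) * V45 (d + 1) a L := by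
    have h3 : a ^ 2 * ctCK (d + 1) a L ^ 2 * kwSum (d + 1) a L * (T * w₁) * V45 (d + 1) a L ≤ kingCbar (d + 1) a L * V45 (d + 1) a L :=
      mul_le_mul_of_nonneg_right hsmall (V45_pos (d + 1) ha hL).le
    rw [kingCbar_mul_V45 (dd := d + 1) ha hL] at h3
    linarith
  have hB : IsUnit (kingTowerPot a m2 L M (t • v) j + kingBlock a L M).det :=
    (Matrix.isUnit_iff_isUnit_det _).mp (isUnit_of_coercive hpos (hco))
  -- the generic lemma at `N = L^{max j 1}`, `a_k`, direction `v_N`, block term `kingBlock`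
  rcases htw with htw | hw0
  · have h := hasDerivAt_covPot_smul (N := N) (U := fine L M) (m2 := m2) hak.le hm.le (hv N) htw (hTw.trans_lt hγ) (kingBlock a L M)
      (by simpa only [kingTowerPot, kingLevelPot, smul_tower_apply] using hB) x y
    simpa only [kingTowerPot, kingLevelPot, smul_tower_apply] using h
  · -- degenerate direction `v = 0`: both sides are constant ∕ zero
    have hv0 : ∀ N', v N' = 0 := fun N' => funext fun x' => by
      have := hv N' x'; rw [hw0] at this; exact abs_nonpos_iff.mp this
    have h := hasDerivAt_covPot_smul (N := N) (U := fine L M) (m2 := m2) (w := v N) (w₀ := wbarK (d + 1) a L) (w₁ := 0) (t := t)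
      hak.le hm.le (fun x' => by rw [hv0 N]; simp) (by rw [mul_zero]; exact (dressedConsts_nonneg (d := d) ha hL).2.2) hγ (kingBlock a L M)
      (by simpa only [kingTowerPot, kingLevelPot, smul_tower_apply] using hB) x y
    simpa only [kingTowerPot, kingLevelPot, smul_tower_apply] using h

/-- **THE DERIVATIVE OF THE FULLY DRESSED COVARIANCE IS EXPONENTIALLY LOCAL, UNIFORMLY IN THE LEVEL AND THE COUPLING**: under the hypotheses of
`hasDerivAt_kingCovPot_smul`, at every level `j`, every `|t| < T` and all sites
`|∂_t C^{(j)}_{tv}(x,y)| ≤ (4∕γ₀)²·(a²·ctCK²·K_W·w₁)·V²·e^{−δ₄₅|x−y|_T}` (`V = V45`, `δ₄₅ = κ′∕2`): the covariance decays at rate `κ′` with constant `4∕γ₀`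
(9c `kingCovPot_decay` at the scaled tower), the dressed sandwich at rate `2κ′` with constant `a²ctCK²K_W·w₁` (9e `dressedSandwich_le` along the run), and
`triple_entry_decay` composes them. [cite: King1986, (4.39)–(4.41) p.675 (A = 0 mechanism)] -/
theorem deriv_kingCovPot_smul_le (ha : 0 < a) (hm : 0 < m2) (hL : 2 ≤ L) {v : ∀ N : ℕ, Tor (fine N (fine L M)) → ℝ} {w₁ T t : ℝ}
    (hv : ∀ N x, |v N x| ≤ w₁) (ht : |t| < T) (hT0 : 0 ≤ T) (hTw : T * w₁ ≤ wbarK (d + 1) a L)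
    (hsmall : a ^ 2 * ctCK (d + 1) a L ^ 2 * kwSum (d + 1) a L * (T * w₁) ≤ kingCbar (d + 1) a L) (j : ℕ) (x y : Tor (fine L M)) :
    |deriv (fun u : ℝ => (kingTowerPot a m2 L M (u • v) j + kingBlock a L M)⁻¹ x y) t|
      ≤ (4 / gam0L (d + 1) a L) ^ 2 * (a ^ 2 * ctCK (d + 1) a L ^ 2 * kwSum (d + 1) a L * w₁) * V45 (d + 1) a L ^ 2
        * Real.exp (-(delta45 (d + 1) a L * tdistT (fine L M) x y)) := by
  have hj : 1 ≤ max j 1 := le_max_right j 1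
  set N := L ^ max j 1 with hN
  have hw₁0 : 0 ≤ w₁ := (abs_nonneg _).trans (hv N (site N (fine L M) x (j0 N)))
  have hTw0 : 0 ≤ T * w₁ := mul_nonneg hT0 hw₁0
  have hvt : ∀ N' x', |(t • v) N' x'| ≤ T * w₁ := fun N' x' =>
    (abs_smul_tower_le hv t N' x').trans (mul_le_mul_of_nonneg_right ht.le hw₁0)
  rw [(hasDerivAt_kingCovPot_smul ha hm hL hv ht hT0 hTw hsmall j x y).deriv, abs_neg]
  -- the three kernels and their letters
  have hκ := (kapCT_pos_le (d := d + 1) ha hL).1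
  have hC := kingCovPot_decay (M := M) ha hm hL hTw0 hTw hvt hsmall j
  have hγ0 := gam0L_pos (d := d + 1) ha hL
  -- the dressed sandwich along the run: rate `4κ′∕2 = 2κ′`, constant `a_k²ctC²K ≤ a²ctCK²K_W` times `w₁`
  obtain ⟨hκ0, hκ1, hgap, hCle⟩ := gap_unif (d := d) ha hL hj hTw
  have hak : 0 < aK a L (max j 1) := aK_pos ha (one_lt_cast_of_two_le hL) hj
  have hκpos : 0 < 4 * kapCT (d + 1) a L := by positivity
  have hlo : ∀ x', -(T * w₁) ≤ (t • v (L ^ max j 1)) x' := fun x' => by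
    have h1 := hvt (L ^ max j 1) x'
    rw [smul_tower_apply] at h1
    exact (abs_le.mp h1).1
  have hD : ∀ z u, |((aK a L (max j 1) ^ 2 * ((L ^ max j 1 : ℕ) : ℝ) ^ (d + 1)) • (Qmat (L ^ max j 1) (fine L M)
      * ((fineOpPot (L ^ max j 1) (fine L M) (aK a L (max j 1)) (((L ^ max j 1 : ℕ) : ℝ) ^ 2) m2 (t • v (L ^ max j 1)))⁻¹
        * Matrix.diagonal (v (L ^ max j 1))
        * (fineOpPot (L ^ max j 1) (fine L M) (aK a L (max j 1)) (((L ^ max j 1 : ℕ) : ℝ) ^ 2) m2 (t • v (L ^ max j 1)))⁻¹)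
      * (Qmat (L ^ max j 1) (fine L M))ᵀ)) z u|
      ≤ a ^ 2 * ctCK (d + 1) a L ^ 2 * kwSum (d + 1) a L * w₁ * Real.exp (-(2 * kapCT (d + 1) a L * tdistT (fine L M) z u)) := by
    intro z u
    rw [Matrix.smul_apply, smul_eq_mul]
    have h := dressedSandwich_le (N := L ^ max j 1) (U := fine L M) (m2 := m2) hak.le hm.le hκpos hκ1 hgap hlo hlo (hv (L ^ max j 1)) z u
    refine h.trans ?_
    have e : 4 * kapCT (d + 1) a L / 2 = 2 * kapCT (d + 1) a L := by ring
    rw [e]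
    refine mul_le_mul_of_nonneg_right ?_ (Real.exp_pos _).le
    obtain ⟨-, hk2⟩ := aminL_le_aK ha hL hj
    have hC0 : 0 ≤ ctC (aK a L (max j 1)) (T * w₁) (4 * kapCT (d + 1) a L) (d + 1) := ctC_nonneg (by exact_mod_cast hgap)
    have hK : latticeConst (d + 1) (2 * kapCT (d + 1) a L) = kwSum (d + 1) a L := rfl
    rw [hK]
    have hKW := (dressedConsts_nonneg (d := d) ha hL).2.1
    gcongr
  have h := triple_entry_decay (isPseudoMetric_tdistT (fine L M)) hκ.le (by positivity) hC hD hC (volumeSum_kingTorus ha hL) x y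
  have e : delta45 (d + 1) a L = kapCT (d + 1) a L / 2 := rfl
  rw [e]
  exact h.trans (le_of_eq (by ring))

end King

end Summit.QuantumFields.YangMills.BalabanUVNodes.N15.KingModel

end
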